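import Summits.AtomisticToContinuum.HydrodynamicLimit.Theorems.MourreKoopmanChargesStressStrongMixingStaticClustering
import Summits.AtomisticToContinuum.HydrodynamicLimit.Theorems.MourreKoopmanChargesStressStrongMixingTwoTimeClustering
import Literature.Analysis.FunctionSpaces.SquaredBesselExistence
import HarnessLib

/-!
# `StressStrongMixing` · line `birth`: stub LocGlue0 `stub_flowLocalityOfInLaw`
# (event-level locality with fourth moments ⇒ exponential `L²` locality of the time-evolved generators)

Closes the registered stub `stub_flowLocalityOfInLaw` of the skeleton `Cruxes/StressStrongMixing/Lines/birth.lean` (crux item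
stmt-AtomisticToContinuum-9584, route `MourreKoopmanCharges` of `AtomisticToContinuum/HydrodynamicLimit`), i.e. the implication
`FlowLocalityInLaw → FlowLocality` of reshape 9: if, for each scale `L`, the time-evolved generator `b ∘ Φ_t` agrees with a measurable
cylinder function `g_L` of `B(0, L)` off an event of measure `≤ K₀ e^{-κ₀ L}`, and `∫ g_L⁴ dμ ≤ C (1 + L)^m`, then
`∫ (b ∘ Φ_t - g_L)² dμ ≤ K e^{-κ L}` with `κ = κ₀/4` (and `g_L ∈ L²(μ)`).

Proof (pure measure theory, census item I5 of the cycle-4 wave-1 worker on `stub_flowLocality`): pointwise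
`(F - g)² ≤ (λ/2)·𝟙_{F ≠ g} + (F - g)⁴/(2λ)` with the weight `λ = e^{3κ₀L/4}`; integrate, use `(F - g)⁴ ≤ 8(F⁴ + g⁴)`,
`μ{F ≠ g} ≤ K₀e^{-κ₀L}` and `(1 + L)^m ≤ m!(2/κ₀)^m e^{κ₀/2} e^{κ₀L/2}`; the fourth moment of `F = b ∘ Φ_t` is that of `b`
(stationarity of the equilibrium flow in the Gibbs state, `integrable_pow_four_of_mem_generators`).

References: H. Spohn, *Large Scale Dynamics of Interacting Particles* (1991), Part I §7.1; R. K. Alexander, *Time evolution for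
infinitely many hard spheres*, Comm. Math. Phys. 49 (1976) §4–5 (finiteness of the interaction clusters behind the intended `g_L`).
-/

noncomputable section

open MeasureTheory ProbabilityTheory Filter Topology
open scoped ENNReal

namespace Summit.AtomisticToContinuum.HydrodynamicLimit.Theorems.MourreKoopmanChargesStressStrongMixing

open Literature.MathematicalPhysics.KineticTheory Literature.Analysis.FluidPDE
open Literature.Analysis.FunctionSpaces (PointConfig maxwellianBeta)

/-! ### Two elementary inequalities (`(a - b)⁴ ≤ 8(a⁴ + b⁴)` is the tree's `pow_four_sub_le`) -/

/-- Weighted AM–GM: `x² ≤ λ/2 + x⁴/(2λ)` for `λ > 0`. [folklore] -/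
theorem sq_le_half_add_pow_four_div {lam : ℝ} (hlam : 0 < lam) (x : ℝ) :
    x ^ 2 ≤ lam / 2 + x ^ 4 / (2 * lam) := by
  rw [div_add_div _ _ two_ne_zero (by positivity : (2 * lam) ≠ 0), le_div_iff₀ (by positivity)]
  nlinarith [sq_nonneg (lam - x ^ 2), hlam]

/-- Polynomials are dominated by exponentials: `(1 + L)^m ≤ m! (2/κ₀)^m e^{κ₀/2} · e^{κ₀L/2}` for `L ≥ 0`, `κ₀ > 0`. [folklore] -/
theorem one_add_pow_le_const_mul_exp {κ₀ : ℝ} (hκ₀ : 0 < κ₀) (m : ℕ) {L : ℝ} (hL : 0 ≤ L) :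
    (1 + L) ^ m ≤ ((m.factorial : ℝ) * (2 / κ₀) ^ m * Real.exp (κ₀ / 2)) * Real.exp (κ₀ * L / 2) := by
  have hx : 0 ≤ κ₀ * (1 + L) / 2 := by positivity
  have h1 := Real.pow_div_factorial_le_exp _ hx m
  have hfac : (0 : ℝ) < m.factorial := by exact_mod_cast m.factorial_pos
  rw [div_le_iff₀ hfac] at h1
  have h2 : (κ₀ * (1 + L) / 2) ^ m = (κ₀ / 2) ^ m * (1 + L) ^ m := by
    rw [← mul_pow]; ring
  rw [h2] at h1
  have hk : (0 : ℝ) < (κ₀ / 2) ^ m := by positivity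
  have hexp : Real.exp (κ₀ * (1 + L) / 2) = Real.exp (κ₀ / 2) * Real.exp (κ₀ * L / 2) := by
    rw [← Real.exp_add]; ring_nf
  have hinv : ((κ₀ / 2) ^ m)⁻¹ = (2 / κ₀) ^ m := by
    rw [← inv_pow, inv_div]
  calc (1 + L) ^ m = ((κ₀ / 2) ^ m)⁻¹ * ((κ₀ / 2) ^ m * (1 + L) ^ m) := by
          rw [← mul_assoc, inv_mul_cancel₀ hk.ne', one_mul]
    _ ≤ ((κ₀ / 2) ^ m)⁻¹ * (Real.exp (κ₀ * (1 + L) / 2) * m.factorial) :=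
          mul_le_mul_of_nonneg_left h1 (by positivity)
    _ = ((m.factorial : ℝ) * (2 / κ₀) ^ m * Real.exp (κ₀ / 2)) * Real.exp (κ₀ * L / 2) := by
          rw [hexp, hinv]; ring

/-! ### The assembly: locality in law with fourth moments gives locality in `L²` -/

/-- **Assembly (census I5).**  On a probability space, let `F` be measurable with `∫ F⁴ < ∞`; suppose that for every `L > 0` there is
a measurable cylinder function `g_L` of `B(0, L)` with `∫ g_L⁴ ≤ C (1 + L)^m` agreeing with `F` off an event of measure `≤ K₀ e^{-κ₀L}`.
Then for every `L > 0` some measurable `g ∈ L²` cylinder function of `B(0, L)` has `∫ (F - g)² ≤ K e^{-κ₀ L/4}`, with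
`K = K₀/2 + 4∫F⁴ + 4|C|·m!(2/κ₀)^m e^{κ₀/2}` (take `g = g_L`; pointwise AM–GM with the weight `e^{3κ₀L/4}`). [folklore] -/
theorem flowLocality_assembly (μ : Measure MarkedConfig) [IsProbabilityMeasure μ] {F : MarkedConfig → ℝ} (hF : Measurable F)
    (hF4 : Integrable (fun ω => F ω ^ 4) μ) {K₀ κ₀ C : ℝ} {m : ℕ} (hK₀ : 0 ≤ K₀) (hκ₀ : 0 < κ₀)
    (h : ∀ L : ℝ, 0 < L → ∃ g : MarkedConfig → ℝ, Measurable g ∧ IsCylinder (Metric.ball (0 : V3) L) g ∧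
      Integrable (fun ω => g ω ^ 4) μ ∧ (∫ ω, g ω ^ 4 ∂μ ≤ C * (1 + L) ^ m) ∧
      μ {ω | F ω ≠ g ω} ≤ ENNReal.ofReal (K₀ * Real.exp (-(κ₀ * L)))) :
    ∃ K κ : ℝ, 0 ≤ K ∧ 0 < κ ∧ ∀ L : ℝ, 0 < L →
      ∃ g : MarkedConfig → ℝ, Measurable g ∧ MemLp g 2 μ ∧ IsCylinder (Metric.ball (0 : V3) L) g ∧
        ∫ ω, (F ω - g ω) ^ 2 ∂μ ≤ K * Real.exp (-(κ * L)) := by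
  have hA0 : 0 ≤ ∫ ω, F ω ^ 4 ∂μ := integral_nonneg fun ω => by positivity
  have hD0 : 0 ≤ (m.factorial : ℝ) * (2 / κ₀) ^ m * Real.exp (κ₀ / 2) := by positivity
  refine ⟨K₀ / 2 + 4 * (∫ ω, F ω ^ 4 ∂μ) + 4 * (|C| * ((m.factorial : ℝ) * (2 / κ₀) ^ m * Real.exp (κ₀ / 2))),
    κ₀ / 4, by positivity, by positivity, fun L hL => ?_⟩
  obtain ⟨g, hg, hcyl, hg4, hg4le, hbad⟩ := h L hL
  have hSm : MeasurableSet {ω | F ω ≠ g ω} := (measurableSet_eq_fun hF hg).compl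
  -- `g ∈ L²`
  have hg2 : Integrable (fun ω => g ω ^ 2) μ := by
    refine ((integrable_const (1 : ℝ)).add hg4).mono' ((hg.pow_const 2).aestronglyMeasurable)
      (Filter.Eventually.of_forall fun ω => ?_)
    rw [Real.norm_eq_abs, abs_of_nonneg (by positivity)]
    show g ω ^ 2 ≤ 1 + g ω ^ 4
    nlinarith [sq_nonneg (g ω ^ 2 - 1), sq_nonneg (g ω)]
  have hmem : MemLp g 2 μ := (memLp_two_iff_integrable_sq hg.aestronglyMeasurable).2 hg2
  refine ⟨g, hg, hmem, hcyl, ?_⟩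
  -- fourth moment of the difference
  have hFg4 : Integrable (fun ω => (F ω - g ω) ^ 4) μ := by
    refine ((hF4.add hg4).const_mul 8).mono' (((hF.sub hg).pow_const 4).aestronglyMeasurable)
      (Filter.Eventually.of_forall fun ω => ?_)
    rw [Real.norm_eq_abs, abs_of_nonneg (by positivity)]
    exact Literature.Analysis.FunctionSpaces.pow_four_sub_le (F ω) (g ω)
  have hFg4le : ∫ ω, (F ω - g ω) ^ 4 ∂μ ≤ 8 * ((∫ ω, F ω ^ 4 ∂μ) + |C| * (1 + L) ^ m) := by
    calc ∫ ω, (F ω - g ω) ^ 4 ∂μ ≤ ∫ ω, 8 * (F ω ^ 4 + g ω ^ 4) ∂μ :=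
          integral_mono hFg4 ((hF4.add hg4).const_mul 8) fun ω => Literature.Analysis.FunctionSpaces.pow_four_sub_le (F ω) (g ω)
      _ = 8 * ((∫ ω, F ω ^ 4 ∂μ) + ∫ ω, g ω ^ 4 ∂μ) := by
          rw [integral_const_mul, integral_add hF4 hg4]
      _ ≤ 8 * ((∫ ω, F ω ^ 4 ∂μ) + |C| * (1 + L) ^ m) := by
          gcongr
          exact hg4le.trans (mul_le_mul_of_nonneg_right (le_abs_self C) (by positivity))
  -- the weight
  set lam : ℝ := Real.exp (3 * κ₀ * L / 4) with hlam
  have hlam0 : 0 < lam := Real.exp_pos _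
  -- pointwise AM–GM off/on the bad set
  have hpt : ∀ ω, (F ω - g ω) ^ 2 ≤
      lam / 2 * {ω | F ω ≠ g ω}.indicator (1 : MarkedConfig → ℝ) ω + (F ω - g ω) ^ 4 / (2 * lam) := by
    intro ω
    by_cases hω : F ω = g ω
    · have : ω ∉ {ω | F ω ≠ g ω} := fun h' => h' hω
      rw [Set.indicator_of_notMem this, hω, sub_self]
      simp
    · have : ω ∈ {ω | F ω ≠ g ω} := hω
      rw [Set.indicator_of_mem this, Pi.one_apply, mul_one]
      exact sq_le_half_add_pow_four_div hlam0 _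
  have hind : Integrable ({ω | F ω ≠ g ω}.indicator (1 : MarkedConfig → ℝ)) μ :=
    (integrable_const (1 : ℝ)).indicator hSm
  have hRint : Integrable (fun ω => lam / 2 * {ω | F ω ≠ g ω}.indicator (1 : MarkedConfig → ℝ) ω +
      (F ω - g ω) ^ 4 / (2 * lam)) μ :=
    (hind.const_mul (lam / 2)).add (hFg4.div_const (2 * lam))
  have hstep1 : ∫ ω, (F ω - g ω) ^ 2 ∂μ ≤
      lam / 2 * μ.real {ω | F ω ≠ g ω} + (∫ ω, (F ω - g ω) ^ 4 ∂μ) / (2 * lam) := by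
    calc ∫ ω, (F ω - g ω) ^ 2 ∂μ
        ≤ ∫ ω, (lam / 2 * {ω | F ω ≠ g ω}.indicator (1 : MarkedConfig → ℝ) ω +
            (F ω - g ω) ^ 4 / (2 * lam)) ∂μ :=
          integral_mono_of_nonneg (Filter.Eventually.of_forall fun ω => by positivity) hRint
            (Filter.Eventually.of_forall hpt)
      _ = lam / 2 * μ.real {ω | F ω ≠ g ω} + (∫ ω, (F ω - g ω) ^ 4 ∂μ) / (2 * lam) := by
          rw [integral_add (hind.const_mul (lam / 2)) (hFg4.div_const (2 * lam)), integral_const_mul,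
            integral_indicator_one hSm, integral_div]
  have hbad' : μ.real {ω | F ω ≠ g ω} ≤ K₀ * Real.exp (-(κ₀ * L)) :=
    ENNReal.toReal_le_of_le_ofReal (by positivity) hbad
  have hpoly := one_add_pow_le_const_mul_exp hκ₀ m hL.le
  -- exponent bookkeeping
  have e1 : lam * Real.exp (-(κ₀ * L)) = Real.exp (-(κ₀ / 4 * L)) := by
    rw [hlam, ← Real.exp_add]; ring_nf
  have e2 : Real.exp (κ₀ * L / 2) / lam = Real.exp (-(κ₀ / 4 * L)) := by
    rw [div_eq_iff hlam0.ne', hlam, ← Real.exp_add]; ring_nf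
  have e3 : 1 / lam ≤ Real.exp (-(κ₀ / 4 * L)) := by
    rw [hlam, one_div, ← Real.exp_neg, Real.exp_le_exp]; nlinarith
  set E := Real.exp (-(κ₀ / 4 * L)) with hE
  have hE0 : 0 < E := Real.exp_pos _
  set A := ∫ ω, F ω ^ 4 ∂μ with hA
  set D := (m.factorial : ℝ) * (2 / κ₀) ^ m * Real.exp (κ₀ / 2) with hD
  -- first term
  have t1 : lam / 2 * μ.real {ω | F ω ≠ g ω} ≤ K₀ / 2 * E := by
    calc lam / 2 * μ.real {ω | F ω ≠ g ω} ≤ lam / 2 * (K₀ * Real.exp (-(κ₀ * L))) :=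
          mul_le_mul_of_nonneg_left hbad' (by positivity)
      _ = K₀ / 2 * (lam * Real.exp (-(κ₀ * L))) := by ring
      _ = K₀ / 2 * E := by rw [e1]
  -- second term
  have t2 : (∫ ω, (F ω - g ω) ^ 4 ∂μ) / (2 * lam) ≤ 4 * A * E + 4 * (|C| * D) * E := by
    have hnum : ∫ ω, (F ω - g ω) ^ 4 ∂μ ≤ 8 * (A + |C| * (D * Real.exp (κ₀ * L / 2))) := by
      refine hFg4le.trans ?_
      gcongr
    calc (∫ ω, (F ω - g ω) ^ 4 ∂μ) / (2 * lam)
        ≤ 8 * (A + |C| * (D * Real.exp (κ₀ * L / 2))) / (2 * lam) :=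
          div_le_div_of_nonneg_right hnum (by positivity)
      _ = 4 * A * (1 / lam) + 4 * (|C| * D) * (Real.exp (κ₀ * L / 2) / lam) := by
          field_simp; ring
      _ ≤ 4 * A * E + 4 * (|C| * D) * E := by
          rw [e2]
          gcongr
  calc ∫ ω, (F ω - g ω) ^ 2 ∂μ
      ≤ lam / 2 * μ.real {ω | F ω ≠ g ω} + (∫ ω, (F ω - g ω) ^ 4 ∂μ) / (2 * lam) := hstep1
    _ ≤ K₀ / 2 * E + (4 * A * E + 4 * (|C| * D) * E) := add_le_add t1 t2
    _ = (K₀ / 2 + 4 * A + 4 * (|C| * D)) * E := by ring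

/-! ### The registered stub -/

/-- **Registered stub `stub_flowLocalityOfInLaw`** (LocGlue0 of the line `birth` of `StressStrongMixing`, reshape 9):
`FlowLocalityInLaw → FlowLocality` — event-level locality of the time-evolved generators with polynomial fourth moments of the
cylinder approximants implies their exponential `L²(μ)` locality (`flowLocality_assembly` with `F = b ∘ Φ_t`, whose fourth moment is
that of `b` by stationarity of the equilibrium flow in the Gibbs state). [folklore] -/
theorem stub_flowLocalityOfInLaw :
    (∃ σ₄ : ℝ, 0 < σ₄ ∧ ∀ σ : ℝ, 0 < σ → σ < σ₄ → ∀ Φ : InfiniteHardSphereFlow (Fin 3) σ,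
      Φ.IsEquilibriumFlow → ∀ θ z : ℝ, 0 < θ → 0 < z →
      ∀ μ : Measure MarkedConfig, IsHardSphereGibbs σ z θ⁻¹ (0 : V3) μ → IsTranslationInvariant μ →
        PointProcess.density μ = 1 →
        ∀ b ∈ Set.range cellCharge ∪ {cellObs fun v : V3 => v 0 * v 1}, ∀ t : ℝ,
          ∃ (K₀ κ₀ C : ℝ) (m : ℕ), 0 ≤ K₀ ∧ 0 < κ₀ ∧ ∀ L : ℝ, 0 < L →
            ∃ g : MarkedConfig → ℝ, Measurable g ∧ IsCylinder (Metric.ball (0 : V3) L) g ∧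
              Integrable (fun ω => g ω ^ 4) μ ∧ (∫ ω, g ω ^ 4 ∂μ ≤ C * (1 + L) ^ m) ∧
              μ {ω | b (Φ.flow t ω) ≠ g ω} ≤ ENNReal.ofReal (K₀ * Real.exp (-(κ₀ * L)))) →
    ∃ σ₄ : ℝ, 0 < σ₄ ∧ ∀ σ : ℝ, 0 < σ → σ < σ₄ → ∀ Φ : InfiniteHardSphereFlow (Fin 3) σ,
      Φ.IsEquilibriumFlow → ∀ θ z : ℝ, 0 < θ → 0 < z →
      ∀ μ : Measure MarkedConfig, IsHardSphereGibbs σ z θ⁻¹ (0 : V3) μ → IsTranslationInvariant μ →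
        PointProcess.density μ = 1 →
        ∀ b ∈ Set.range cellCharge ∪ {cellObs fun v : V3 => v 0 * v 1}, ∀ t : ℝ,
          ∃ K κ : ℝ, 0 ≤ K ∧ 0 < κ ∧ ∀ L : ℝ, 0 < L →
            ∃ g : MarkedConfig → ℝ, Measurable g ∧ MemLp g 2 μ ∧ IsCylinder (Metric.ball (0 : V3) L) g ∧
              ∫ ω, (b (Φ.flow t ω) - g ω) ^ 2 ∂μ ≤ K * Real.exp (-(κ * L)) := by
  rintro ⟨σ₄, hσ₄, H⟩
  refine ⟨σ₄, hσ₄, fun σ hσ hσ' Φ hΦ θ z hθ hz μ hG hti hρ b hb t => ?_⟩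
  obtain ⟨K₀, κ₀, C, m, hK₀, hκ₀, h⟩ := H σ hσ hσ' Φ hΦ θ z hθ hz μ hG hti hρ b hb t
  haveI : IsProbabilityMeasure μ := hG.1
  have hS : Φ.IsStationary μ := (hΦ z θ⁻¹ hz (inv_pos.2 hθ) μ hG).2
  have hbm : Measurable b := measurable_of_mem_generators b hb
  have hF : Measurable (fun ω => b (Φ.flow t ω)) := hbm.comp (Φ.measurable_flow t)
  have hb4 : Integrable (fun ω => b ω ^ 4) μ := integrable_pow_four_of_mem_generators hθ hz hG hb
  have hF4 : Integrable (fun ω => b (Φ.flow t ω) ^ 4) μ :=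
    ((hS.measurePreserving t).integrable_comp (hbm.pow_const 4).aestronglyMeasurable).2 hb4
  exact flowLocality_assembly μ hF hF4 hK₀ hκ₀ h

end Summit.AtomisticToContinuum.HydrodynamicLimit.Theorems.MourreKoopmanChargesStressStrongMixing

end
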